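import Literature.NumberTheory.GelbartRogawski1991.LocalDoubledUnitaryDatum
import Literature.NumberTheory.Automorphic.QuadraticAdeleBaseChange
import Literature.NumberTheory.Automorphic.GlobalAdditiveCharacter
import Literature.NumberTheory.Automorphic.LocalPiSchwartzBruhatFourier
import HarnessLib

/-!
# The local unitary group at a good place preserves the standard lattice of `𝕎_v`
# ([GelbartRogawski1991, §3.1 (3.1.3)]; [MoeglinVignerasWaldspurger1987, Chap. 2 II.10])

Topic `NumberTheory/GelbartRogawski1991`; namespace
`Literature.NumberTheory.GelbartRogawski1991.UnitaryDualPair.LocalSplitting` (sequel of `LocalUnitarySplittingDatum`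
∕ `LocalDoubledUnitaryDatum`).  KERNEL only: proved lemmas; no named fact, no `sorry`.

Setting: `E/F` quadratic (CM in the application), `c` the non-trivial automorphism, `δ ∈ E` with `c δ = −δ ≠ 0`,
`δ² = d ∈ F`; a finite place `v` of `F`; the local symplectic space `𝕎_v = F_v^N × F_v^N` of the tree's Schrödinger
model and the embedding `ι_v : U(J)(F_v) → Sp(𝕎_v)` (`iota`, through the quadratic coordinates
`reIm : (E ⊗ F_v)^N ≃ F_v^N × F_v^N`, `u ↦ (re u, im u)`, `u = ι_v(re u) + ι_v(im u)·δ`).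

Call `v` GOOD (for `δ`) when at every place `w ∣ v` of `E` one has `|2|_w = 1` and `|δ|_w = 1` (all but finitely many
`v`).  Then the lattice `𝒪_w`-points of `E ⊗ F_v = ∏_{w ∣ v} E_w` correspond under `reIm` to `𝒪_v × 𝒪_v`:
`re z, im z ∈ 𝒪_v` whenever all components of `z` are integral (`valued_re_le_one`, `valued_im_le_one`: `2 re z =
z + c z`, `2δ · im z = z − c z`, and `c` is an isometry `E_{c⁻¹w} → E_w`, tree `valued_galAdicCompletionMap`), and
conversely (`isIntegralLoc_psiLoc`).  CONSEQUENCE (`iota_mapsTo_integral`): **for `k ∈ U(J)(𝒪_v)`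
(`UnitaryGroup.localInt`: every component `k_w ∈ GL_N(𝒪_w)`), `ι_v(k)` maps the standard lattice
`𝒪_v^N × 𝒪_v^N ⊆ 𝕎_v` into itself** — the hypothesis «`g(𝒪^N × 𝒪^N) ⊆ 𝒪^N × 𝒪^N`» under which an implementer of
`g` on the Schrödinger model fixes the line of the unramified vector `1_{𝒪^N}` [MoeglinVignerasWaldspurger1987,
Chap. 2 II.10], i.e. the `H`-side input of the unramified clause of [GelbartRogawski1991, §3.1 (3.1.3)] («for almost
all `v`, `K_v` fixes `Φ_v^0`»).  Written for the kernel construction of [GelbartRogawski1991, Prop. 3.1.1] (stage-1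
cell `pub-hodgecm`, seat GR-1; input of bricks L7c∕L7d of the local skeleton, 2026-08-21).

## References

* S. Gelbart, J. Rogawski, *L-functions and Fourier–Jacobi coefficients for the unitary group U(3)*, Invent. Math.
  105 (1991) 445–472, §3.1 (3.1.3) [GelbartRogawski1991].
* C. Mœglin, M.-F. Vignéras, J.-L. Waldspurger, *Correspondances de Howe sur un corps p-adique*, LNM 1291 (1987),
  Chap. 2 II.10 [MoeglinVignerasWaldspurger1987].
* J. W. S. Cassels, A. Fröhlich (eds.), *Algebraic Number Theory* (1967), Ch. II §10, Ch. VII §1.1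
  [CasselsFrohlichANT1967].
-/

set_option autoImplicit false

noncomputable section

open NumberField IsDedekindDomain Matrix
open scoped ValuativeRel
open Literature.NumberTheory.Automorphic Literature.NumberTheory.Automorphic.UnitaryGroup
open Literature.NumberTheory.Automorphic.UnitaryGroup.QuadraticCoordinates
open Literature.NumberTheory.GaloisRepresentations.IsNonarchimedeanLocalField

namespace Literature.NumberTheory.GelbartRogawski1991.UnitaryDualPair.LocalSplitting

variable (F : Type) [Field F] [NumberField F] (E : Type) [Field E] [NumberField E] [Algebra F E]
  [Algebra.IsQuadraticExtension F E] (c : E ≃ₐ[F] E)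
  {δ : E} (hcδ : c δ = -δ) (hδ : δ ≠ 0) {d : F} (hd : δ * δ = algebraMap F E d)
  (v : HeightOneSpectrum (𝓞 F))

local notation "Kv" => HeightOneSpectrum.adicCompletion F v
local notation "S" => LocalRing E v

/-! ## §1 Valuation bookkeeping on `E_w` and `F_v` -/

/-- the two valuations of `E_w` define the same unit ball. [cite: CasselsFrohlichANT1967, Ch. II §10] -/
theorem valuation_le_one_iff_valued (w : HeightOneSpectrum (𝓞 E)) (x : w.adicCompletion E) :
    ValuativeRel.valuation (w.adicCompletion E) x ≤ 1 ↔ Valued.v x ≤ 1 := by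
  rw [← Valuation.vle_one_iff (ValuativeRel.valuation (w.adicCompletion E)),
    Valuation.vle_one_iff (Valued.v : Valuation (w.adicCompletion E) (WithZero (Multiplicative ℤ)))]

omit [NumberField E] [Algebra.IsQuadraticExtension F E] in
/-- `𝔭_v^0 = 𝒪_v = {x | v(x) ≤ 1}` in `F_v`. [cite: CasselsFrohlichANT1967, Ch. II §10] -/
theorem mem_primePowBall_zero_iff_valued (x : Kv) : x ∈ primePowBall Kv 0 ↔ Valued.v x ≤ 1 := by
  rw [mem_primePowBall_zero_iff, HeightOneSpectrum.mem_adicCompletionIntegers]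

/-- **`x ∈ E ⊗ F_v` is integral**: every component `x_w ∈ 𝒪_w`. [cite: CasselsFrohlichANT1967, Ch. II §10] -/
def IsIntegralLoc (x : S) : Prop :=
  ∀ w : PlacesOver E v, ValuativeRel.valuation (w.1.adicCompletion E) (x w) ≤ 1

namespace IsIntegralLoc

variable {F E v}

omit [NumberField F] [Algebra.IsQuadraticExtension F E] in
/-- sums. [cite: CasselsFrohlichANT1967, Ch. II §10] -/
theorem add {x y : S} (hx : IsIntegralLoc F E v x) (hy : IsIntegralLoc F E v y) : IsIntegralLoc F E v (x + y) :=
  fun w => by rw [Pi.add_apply]; exact Valuation.map_add_le _ (hx w) (hy w)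

omit [NumberField F] [Algebra.IsQuadraticExtension F E] in
/-- negatives. [cite: CasselsFrohlichANT1967, Ch. II §10] -/
theorem neg {x : S} (hx : IsIntegralLoc F E v x) : IsIntegralLoc F E v (-x) :=
  fun w => by rw [Pi.neg_apply, Valuation.map_neg]; exact hx w

omit [NumberField F] [Algebra.IsQuadraticExtension F E] in
/-- differences. [cite: CasselsFrohlichANT1967, Ch. II §10] -/
theorem sub {x y : S} (hx : IsIntegralLoc F E v x) (hy : IsIntegralLoc F E v y) : IsIntegralLoc F E v (x - y) := by
  rw [sub_eq_add_neg]; exact hx.add hy.neg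

omit [NumberField F] [Algebra.IsQuadraticExtension F E] in
/-- products. [cite: CasselsFrohlichANT1967, Ch. II §10] -/
theorem mul {x y : S} (hx : IsIntegralLoc F E v x) (hy : IsIntegralLoc F E v y) : IsIntegralLoc F E v (x * y) :=
  fun w => by rw [Pi.mul_apply, map_mul]; exact mul_le_one' (hx w) (hy w)

omit [NumberField F] [Algebra.IsQuadraticExtension F E] in
/-- `0`. [cite: CasselsFrohlichANT1967, Ch. II §10] -/
theorem zero : IsIntegralLoc F E v (0 : S) := fun w => by simp

omit [NumberField F] [Algebra.IsQuadraticExtension F E] in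
/-- finite sums. [cite: CasselsFrohlichANT1967, Ch. II §10] -/
theorem sum {ι : Type*} (s : Finset ι) {f : ι → S} (hf : ∀ i ∈ s, IsIntegralLoc F E v (f i)) :
    IsIntegralLoc F E v (∑ i ∈ s, f i) := by
  classical
  induction s using Finset.induction_on with
  | empty => rw [Finset.sum_empty]; exact zero
  | insert a s ha ih =>
    rw [Finset.sum_insert ha]
    exact (hf a (Finset.mem_insert_self a s)).add (ih fun i hi => hf i (Finset.mem_insert_of_mem hi))

omit [Algebra.IsQuadraticExtension F E] in
/-- **`c ⊗ 1` preserves integrality** (`|c y|_w = |y|_{c⁻¹ w}`, tree `valued_galAdicCompletionMap`).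
[cite: CasselsFrohlichANT1967, Ch. VII §1.1] -/
theorem conj {x : S} (hx : IsIntegralLoc F E v x) : IsIntegralLoc F E v (conjLocal E c v x) := by
  intro w
  rw [conjLocal_apply, valuation_le_one_iff_valued, valued_galAdicCompletionMap, ← valuation_le_one_iff_valued]
  exact hx _

end IsIntegralLoc

omit [Algebra.IsQuadraticExtension F E] in
/-- `ι_v(a)` is integral iff `a ∈ 𝒪_v` (`v_w ∘ ι_w = v_v^{e}`, tree `valued_toPlace_le_one_iff`).
[cite: CasselsFrohlichANT1967, Ch. II §10] -/
theorem isIntegralLoc_toLocalRing_iff (a : Kv) : IsIntegralLoc F E v (toLocalRing E v a) ↔ Valued.v a ≤ 1 := by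
  constructor
  · intro h
    obtain ⟨w⟩ := (inferInstance : Nonempty (PlacesOver E v))
    have hw := h w
    rw [toLocalRing_apply, valuation_le_one_iff_valued, valued_toPlace_le_one_iff] at hw
    exact hw
  · intro h w
    rw [toLocalRing_apply, valuation_le_one_iff_valued, valued_toPlace_le_one_iff]
    exact h

omit [NumberField F] [Algebra.IsQuadraticExtension F E] in
/-- `e ⊗ 1` is integral when `|e|_w ≤ 1` at every `w ∣ v`. [cite: CasselsFrohlichANT1967, Ch. II §10] -/
theorem isIntegralLoc_algebraMap {e : E}
    (he : ∀ w : PlacesOver E v, ValuativeRel.valuation (w.1.adicCompletion E) (e : w.1.adicCompletion E) ≤ 1) :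
    IsIntegralLoc F E v (algebraMap E S e) := fun w => he w

/-! ## §2 `re`, `im` of an integral element at a good place -/

section Good

variable (h2 : ∀ w : PlacesOver E v, ValuativeRel.valuation (w.1.adicCompletion E) (2 : w.1.adicCompletion E) = 1)
  (hδ1 : ∀ w : PlacesOver E v, ValuativeRel.valuation (w.1.adicCompletion E) (δ : w.1.adicCompletion E) = 1)

/-- the quadratic coordinates `Ψ_v : F_v × F_v ≃ E ⊗ F_v` as an additive equivalence. [cite: CasselsFrohlichANT1967, Ch. II §10] -/
abbrev psiLoc : (Kv × Kv) ≃+ S := (quadraticLocalEquiv E v c hcδ hδ).toLinearEquiv.toAddEquiv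

include hd in
/-- `x = ι_v(re x) + ι_v(im x)·δ` and `c x = ι_v(re x) − ι_v(im x)·δ`. [cite: CasselsFrohlichANT1967, Ch. II §10] -/
theorem eq_re_add_im_and_conj (x : S) :
    x = toLocalRing E v (re (psiLoc F E c hcδ hδ v) x) + toLocalRing E v (im (psiLoc F E c hcδ hδ v) x) * algebraMap E S δ ∧
    conjLocal E c v x =
      toLocalRing E v (re (psiLoc F E c hcδ hδ v) x) - toLocalRing E v (im (psiLoc F E c hcδ hδ v) x) * algebraMap E S δ := by
  have hq := isQuadraticCoordinates_local E v c hcδ hδ hd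
  have h1 : x = toLocalRing E v (re (psiLoc F E c hcδ hδ v) x) +
      toLocalRing E v (im (psiLoc F E c hcδ hδ v) x) * algebraMap E S δ := by
    conv_lhs => rw [← apply_re_im (psiLoc F E c hcδ hδ v) x]
    exact hq.apply _ _
  refine ⟨h1, ?_⟩
  conv_lhs => rw [h1]
  rw [map_add, map_mul, conjLocal_toLocalRing, conjLocal_toLocalRing, conjLocal_algebraMap, hcδ, map_neg, mul_neg,
    sub_eq_add_neg]

include hd h2 in
/-- **`re z ∈ 𝒪_v` for integral `z`** at a good place: `2·ι_v(re z) = z + c z`. [cite: CasselsFrohlichANT1967, Ch. II §10] -/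
theorem valued_re_le_one {x : S} (hx : IsIntegralLoc F E v x) : Valued.v (re (psiLoc F E c hcδ hδ v) x) ≤ 1 := by
  rw [← isIntegralLoc_toLocalRing_iff F E v]
  obtain ⟨h1, h1c⟩ := eq_re_add_im_and_conj F E c hcδ hδ hd v x
  -- `ι(re x) * 2 = x + c x`
  have hsum : toLocalRing E v (re (psiLoc F E c hcδ hδ v) x) * 2 = x + conjLocal E c v x := by
    calc toLocalRing E v (re (psiLoc F E c hcδ hδ v) x) * 2
        = (toLocalRing E v (re (psiLoc F E c hcδ hδ v) x) + toLocalRing E v (im (psiLoc F E c hcδ hδ v) x) * algebraMap E S δ) +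
          (toLocalRing E v (re (psiLoc F E c hcδ hδ v) x) - toLocalRing E v (im (psiLoc F E c hcδ hδ v) x) * algebraMap E S δ) := by
          ring
      _ = x + conjLocal E c v x := by rw [← h1c, ← h1]
  intro w
  have hw := congrArg (fun y : S => ValuativeRel.valuation (w.1.adicCompletion E) (y w)) hsum
  simp only [Pi.mul_apply, map_mul] at hw
  have h2w : ValuativeRel.valuation (w.1.adicCompletion E) ((2 : S) w) = 1 := h2 w
  rw [h2w, mul_one] at hw
  rw [hw]
  exact (hx.add (hx.conj c)) w

include hd h2 hδ1 in
/-- **`im z ∈ 𝒪_v` for integral `z`** at a good place: `2δ·ι_v(im z) = z − c z`. [cite: CasselsFrohlichANT1967, Ch. II §10] -/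
theorem valued_im_le_one {x : S} (hx : IsIntegralLoc F E v x) : Valued.v (im (psiLoc F E c hcδ hδ v) x) ≤ 1 := by
  rw [← isIntegralLoc_toLocalRing_iff F E v]
  obtain ⟨h1, h1c⟩ := eq_re_add_im_and_conj F E c hcδ hδ hd v x
  -- `ι(im x) * (δ * 2) = x − c x`
  have hdiff : toLocalRing E v (im (psiLoc F E c hcδ hδ v) x) * (algebraMap E S δ * 2) = x - conjLocal E c v x := by
    calc toLocalRing E v (im (psiLoc F E c hcδ hδ v) x) * (algebraMap E S δ * 2)
        = (toLocalRing E v (re (psiLoc F E c hcδ hδ v) x) + toLocalRing E v (im (psiLoc F E c hcδ hδ v) x) * algebraMap E S δ) -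
          (toLocalRing E v (re (psiLoc F E c hcδ hδ v) x) - toLocalRing E v (im (psiLoc F E c hcδ hδ v) x) * algebraMap E S δ) := by
          ring
      _ = x - conjLocal E c v x := by rw [← h1c, ← h1]
  intro w
  have hw := congrArg (fun y : S => ValuativeRel.valuation (w.1.adicCompletion E) (y w)) hdiff
  simp only [Pi.mul_apply, map_mul] at hw
  have h2w : ValuativeRel.valuation (w.1.adicCompletion E) ((2 : S) w) = 1 := h2 w
  have hδw : ValuativeRel.valuation (w.1.adicCompletion E) ((algebraMap E S δ) w) = 1 := hδ1 w
  rw [h2w, hδw, mul_one, mul_one] at hw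
  rw [hw]
  exact (hx.sub (hx.conj c)) w

include hd hδ1 in
/-- conversely `Ψ_v(a, b) = ι_v a + ι_v b·δ` is integral for `a, b ∈ 𝒪_v` (needs only `|δ|_w ≤ 1`).
[cite: CasselsFrohlichANT1967, Ch. II §10] -/
theorem isIntegralLoc_psiLoc {a b : Kv} (ha : Valued.v a ≤ 1) (hb : Valued.v b ≤ 1) :
    IsIntegralLoc F E v (psiLoc F E c hcδ hδ v (a, b)) := by
  have hq := isQuadraticCoordinates_local E v c hcδ hδ hd
  have : psiLoc F E c hcδ hδ v (a, b) = toLocalRing E v a + toLocalRing E v b * algebraMap E S δ := hq.apply a b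
  rw [this]
  exact ((isIntegralLoc_toLocalRing_iff F E v a).2 ha).add
    (((isIntegralLoc_toLocalRing_iff F E v b).2 hb).mul (isIntegralLoc_algebraMap F E v fun w => (hδ1 w).le))

end Good

/-! ## §3 `ι_v(k)` preserves `𝒪_v^N × 𝒪_v^N` for `k ∈ U(J)(𝒪_v)` -/

section Iota

variable (N : ℕ) {T : Matrix (Fin N) (Fin N) F} (hT : T.IsSymm) {J : Matrix (Fin N) (Fin N) E} (hJ : J = T.map (algebraMap F E))

/-- the matrix of `k ∈ U(J)(F_v)` over `E ⊗ F_v = ∏_{w ∣ v} E_w` (regrouped along `GL(∏ E_w) = ∏ GL(E_w)`). [cite: CasselsFrohlichANT1967, Ch. II §10] -/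
abbrev matLoc (k : UnitaryGroup.localPi E c N J v) : Matrix (Fin N) (Fin N) S :=
  ((localPiEquiv E c N J v k : UnitaryGroup.local E c N J v) : GL (Fin N) S).1

omit [Algebra.IsQuadraticExtension F E] in
/-- entries of `matLoc k`: `(matLoc k)_{ij, w} = (k_w)_{ij}` (definitional; `E ⊗ F_v = ∏_w E_w`). [cite: CasselsFrohlichANT1967, Ch. II §10] -/
theorem matLoc_apply (k : UnitaryGroup.localPi E c N J v) (i j : Fin N) (w : PlacesOver E v) :
    matLoc F E c v N k i j w =
      (((k : UnitaryGroup.LocalGLPi E N v) w : GL (Fin N) (w.1.adicCompletion E)) :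
        Matrix (Fin N) (Fin N) (w.1.adicCompletion E)) i j := rfl

/-- `ι_v(k)(reIm u) = reIm (k u)` on `(E ⊗ F_v)^N`, `k` acting through its matrix over `E ⊗ F_v`
(the tree's `localToSymplectic_reIm` through `iota_def`). [cite: MoeglinVignerasWaldspurger1987, Ch. 1 I.17] -/
theorem iota_reIm (k : UnitaryGroup.localPi E c N J v) (u : Fin N → S) :
    toLin F v (iota F E c N hcδ hδ hd T hT hJ v k) (reIm (psiLoc F E c hcδ hδ v) (Fin N) u) =
      reIm (psiLoc F E c hcδ hδ v) (Fin N) (matLoc F E c v N k *ᵥ u) := by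
  rw [iota_def, localPiToSymplectic, MonoidHom.comp_apply]
  exact localToSymplectic_reIm E c N v hcδ hδ hd hT hJ (localPiEquiv E c N J v k) u

omit [Algebra.IsQuadraticExtension F E] in
/-- the matrix of `k ∈ U(J)(𝒪_v)` over `E ⊗ F_v` has integral entries (component `w` = `k_w ∈ GL_N(𝒪_w)`).
[cite: GelbartRogawski1991, §3.1 (3.1.3)] -/
theorem isIntegralLoc_matLoc_of_mem_localInt {k : UnitaryGroup.localPi E c N J v}
    (hk : k ∈ UnitaryGroup.localInt E c N J v) (i j : Fin N) : IsIntegralLoc F E v (matLoc F E c v N k i j) := by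
  intro w
  rw [matLoc_apply]
  exact (Valuation.mem_integer_iff _ _).1 (((mem_glInt_iff _).1 ((mem_localInt_iff E c N J v k).1 hk w)).1 i j)

omit [NumberField F] [Algebra.IsQuadraticExtension F E] in
/-- an integral matrix times an integral vector is integral. [cite: GelbartRogawski1991, §3.1 (3.1.3)] -/
theorem isIntegralLoc_mulVec {M : Matrix (Fin N) (Fin N) S} (hM : ∀ i j, IsIntegralLoc F E v (M i j)) {u : Fin N → S}
    (hu : ∀ i, IsIntegralLoc F E v (u i)) (i : Fin N) : IsIntegralLoc F E v ((M *ᵥ u) i) := by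
  rw [Matrix.mulVec, dotProduct]
  exact IsIntegralLoc.sum _ fun j _ => (hM i j).mul (hu j)

include hd in
/-- **THE LATTICE LEMMA.** At a good place (`|2|_w = |δ|_w = 1` for all `w ∣ v`), for `k ∈ U(J)(𝒪_v)` and
`(a, b) ∈ 𝒪_v^N × 𝒪_v^N`, the vector `ι_v(k)(a, b)` lies in `𝒪_v^N × 𝒪_v^N` (coordinatewise valuation form).
[cite: GelbartRogawski1991, §3.1 (3.1.3); MoeglinVignerasWaldspurger1987, Chap. 2 II.10] -/
theorem valued_iota_apply_le_one
    (h2 : ∀ w : PlacesOver E v, ValuativeRel.valuation (w.1.adicCompletion E) (2 : w.1.adicCompletion E) = 1)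
    (hδ1 : ∀ w : PlacesOver E v, ValuativeRel.valuation (w.1.adicCompletion E) (δ : w.1.adicCompletion E) = 1)
    {k : UnitaryGroup.localPi E c N J v} (hk : k ∈ UnitaryGroup.localInt E c N J v)
    {x : (Fin N → Kv) × (Fin N → Kv)} (ha : ∀ i, Valued.v (x.1 i) ≤ 1) (hb : ∀ i, Valued.v (x.2 i) ≤ 1) :
    (∀ i, Valued.v ((toLin F v (iota F E c N hcδ hδ hd T hT hJ v k) x).1 i) ≤ 1) ∧
      ∀ i, Valued.v ((toLin F v (iota F E c N hcδ hδ hd T hT hJ v k) x).2 i) ≤ 1 := by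
  -- `x = reIm u` with `u` integral
  set Ψ := psiLoc F E c hcδ hδ v with hΨ
  set u : Fin N → S := (reIm Ψ (Fin N)).symm x with hu
  have hx : x = reIm Ψ (Fin N) u := by rw [hu, AddEquiv.apply_symm_apply]
  have hui : ∀ i, IsIntegralLoc F E v (u i) := fun i => by
    rw [hu, reIm_symm_apply]
    exact isIntegralLoc_psiLoc F E c hcδ hδ hd v hδ1 (ha i) (hb i)
  rw [hx, iota_reIm]
  have hu'i : ∀ i, IsIntegralLoc F E v ((matLoc F E c v N k *ᵥ u) i) :=
    isIntegralLoc_mulVec F E v N (isIntegralLoc_matLoc_of_mem_localInt F E c v N hk) hui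
  exact ⟨fun i => valued_re_le_one F E c hcδ hδ hd v h2 (hu'i i), fun i => valued_im_le_one F E c hcδ hδ hd v h2 hδ1 (hu'i i)⟩

include hd in
/-- **THE LATTICE LEMMA, `Set.MapsTo` form** on `𝔭_v^0 × ⋯ × 𝔭_v^0` (`piPrimePowBall F_v (Fin N) 0`): for
`k ∈ U(J)(𝒪_v)` at a good place, `ι_v(k)` maps `𝒪_v^N × 𝒪_v^N` into itself.
[cite: GelbartRogawski1991, §3.1 (3.1.3); MoeglinVignerasWaldspurger1987, Chap. 2 II.10] -/
theorem iota_mapsTo_integral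
    (h2 : ∀ w : PlacesOver E v, ValuativeRel.valuation (w.1.adicCompletion E) (2 : w.1.adicCompletion E) = 1)
    (hδ1 : ∀ w : PlacesOver E v, ValuativeRel.valuation (w.1.adicCompletion E) (δ : w.1.adicCompletion E) = 1)
    {k : UnitaryGroup.localPi E c N J v} (hk : k ∈ UnitaryGroup.localInt E c N J v) :
    Set.MapsTo (toLin F v (iota F E c N hcδ hδ hd T hT hJ v k))
      ((piPrimePowBall Kv (Fin N) 0) ×ˢ (piPrimePowBall Kv (Fin N) 0))
      ((piPrimePowBall Kv (Fin N) 0) ×ˢ (piPrimePowBall Kv (Fin N) 0)) := by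
  intro x hx
  rw [Set.mem_prod, mem_piPrimePowBall_iff, mem_piPrimePowBall_iff] at hx ⊢
  simp only [mem_primePowBall_zero_iff_valued] at hx ⊢
  exact valued_iota_apply_le_one F E c hcδ hδ hd v N hT hJ h2 hδ1 hk hx.1 hx.2

include hd in
/-- the same for `k⁻¹` (so `ι_v(k)` maps the lattice ONTO itself). [cite: GelbartRogawski1991, §3.1 (3.1.3)] -/
theorem iota_inv_mapsTo_integral
    (h2 : ∀ w : PlacesOver E v, ValuativeRel.valuation (w.1.adicCompletion E) (2 : w.1.adicCompletion E) = 1)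
    (hδ1 : ∀ w : PlacesOver E v, ValuativeRel.valuation (w.1.adicCompletion E) (δ : w.1.adicCompletion E) = 1)
    {k : UnitaryGroup.localPi E c N J v} (hk : k ∈ UnitaryGroup.localInt E c N J v) :
    Set.MapsTo (toLin F v (iota F E c N hcδ hδ hd T hT hJ v k)⁻¹)
      ((piPrimePowBall Kv (Fin N) 0) ×ˢ (piPrimePowBall Kv (Fin N) 0))
      ((piPrimePowBall Kv (Fin N) 0) ×ˢ (piPrimePowBall Kv (Fin N) 0)) := by
  rw [← map_inv]
  exact iota_mapsTo_integral F E c hcδ hδ hd v N hT hJ h2 hδ1 (Subgroup.inv_mem _ hk)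

end Iota

end Literature.NumberTheory.GelbartRogawski1991.UnitaryDualPair.LocalSplitting

end
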